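import Mathlib.Analysis.SpecialFunctions.Trigonometric.EulerSineProd
import Mathlib.Analysis.PSeries
import Mathlib.NumberTheory.Harmonic.EulerMascheroni
import Mathlib.Data.Nat.Factorial.DoubleFactorial
import Literature.Probability.LatticeModels.PlanarIsingOnePoint
import HarnessLib

/-!
# Wu's asymptotics `ϱ(δ) ∼ 𝒞₂ δ^{1/4}`: the closed form `wuDiag` and the analytic half

Towards the discharge of the named fact `Literature.Probability.LatticeModels.wu_rhoCHI`
(`PlanarIsingOnePoint.lean`; Chelkak–Hongler–Izyurov, Ann. of Math. 181 (2015), Remark 1.2 (iii),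
after T. T. Wu, Phys. Rev. 149 (1966) 380 and McCoy–Wu, *The two-dimensional Ising model* (1973)):
`∃ C₂ > 0, δ^{-1/4} ϱ(δ) → C₂` as `δ → 0⁺`, where `ϱ(δ) = ⟨σ_{(0,0)} σ_{(N,N)}⟩⁺_{β_c(2)}`,
`N = round(√2/(2δ))`, is the critical plus-state two-point function of `ℤ²` along the diagonal
(`rhoCHI`). `wu_rhoCHI_of_tendsto_diag` (`PlanarIsingOnePoint.lean`) already reduces `wu_rhoCHI` to
Wu's theorem in its printed lattice form, `N^{1/4} ⟨σ_{(0,0)}σ_{(N,N)}⟩⁺_{β_c(2)} → A > 0` along the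
integers. The printed proof of the latter has two halves of very different weight.

* **The exact solution** (Wu 1966; McCoy–Wu 1973, Chs. VIII and XI; in the form used here:
  Perk–Au-Yang, J. Stat. Phys. 135 (2009) 599, §2, "the self-dual case `k = 1` … a simple formula,
  which was already known to Onsager, discussed in detail by McCoy and Wu":
  `log C(n,n) = log C(n-1,n-1) + r_n`, `r_1 = log(2/π)`, `r_{n+1} = r_n - log(1 - 1/(4n²))`, and
  §4: `X_n(0) = ⟨σ_{00}σ_{nn}⟩ = (2/π)^n ∏_{l=1}^{n-1} (1 - 1/(4l²))^{l-n}` for `J = B`): at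
  criticality the diagonal correlation of the square lattice is a Toeplitz determinant with the
  Cauchy-type entries `1/(π(i-j+½))`, whence the closed form `wuDiag N` below. Its derivation
  (Pfaffians or the diagonal transfer matrix, the thermodynamic limit, and the identification of
  the resulting state with the `+` state at `β_c`) is a theory of its own and is **not** formalised
  here; the tree's exact-solution programme (`IsingTransferOperator` … `IsingRowDeterminant`,
  `OnsagerToeplitz`) treats the *row* correlation of the cylinder state at `β ≠ β_c` and stops at
  finite width. In accordance with D-0026 this input is **not** vendored as a further named fact:
  it enters `wu_rhoCHI_of_twoPointPlus_diag_eq` as an explicit hypothesis.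
* **The analysis**: `N^{1/4} · (2/π)^N ∏_{l=1}^{N-1} (1 - 1/(4l²))^{l-N}` converges to a positive
  limit (Wu: `A = 2^{1/12} e^{3ζ'(-1)} = 0.6450…`; only existence and positivity of the limit are
  proved, which is all `wu_rhoCHI` asks for). This is `exists_tendsto_rpow_mul_wuDiag`, proved
  here from Euler's product `∏_{l ≥ 1} (1 - 1/(4l²)) = 2/π` (Mathlib's `Real.tendsto_euler_sin_prod`
  at `x = 1/2`), the Euler–Mascheroni asymptotics of the harmonic numbers
  (`Real.tendsto_harmonic_sub_log_add_one`) and elementary tail estimates: with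
  `u_l = -log(1 - 1/(4l²)) = 1/(4l²) + r_l`, `0 ≤ r_l ≤ 1/(12 l⁴)`, one has
  `log P_N = -N ∑_{l ≥ N} u_l - ∑_{l < N} l u_l`, `N ∑_{l ≥ N} u_l → 1/4` (telescoping bounds
  `1/N ≤ ∑_{l ≥ N} 1/l² ≤ 1/(N-1)`), and `∑_{l<N} l u_l = ¼ H_{N-1} + ∑_{l<N} l r_l` with
  `∑ l r_l < ∞`; hence `log P_N + ¼ log N → -¼ - ¼γ - ∑_{l ≥ 1} l r_l`.

* **The recurrence form** (last section): `wuDiag 0 = 1`, `wuDiag (n+1) = wuDiag n · ρ_n` with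
  `ρ_n = (2/π)((2n)‼)²/((2n-1)‼(2n+1)‼) = (2/π)/∏_{l ≤ n}(1 - 1/(4l²))` (`wuRatio`,
  `prod_wuFactor_eq_doubleFactorial`, `wuDiag_succ_eq_mul_wuRatio`, `eq_wuDiag_of_wuRatio`) — the
  form in which Chelkak–Hongler–Mahfouf (Ann. Inst. Fourier 2024 = arXiv:1904.09168, Appendix,
  Thm 6.3 "(Wu)") obtain Wu's formula from a full-plane Kadanoff–Ceva spinor and the norms of the
  Legendre polynomials; `wu_rhoCHI_of_twoPointPlus_diag_ratio` is the corresponding glue.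

* **CHM's form of the ratio** (last section): `ρ_n = 2^{2n+1} / (π (2n+1) p_n²)` with
  `p_n = (2n)!/(2ⁿ(n!)²)` the leading coefficient of the Legendre polynomial `P_n` (this is
  `Literature.Analysis.SpecialFunctions.legendreLead n` of `LegendrePolynomials.lean`, where
  `∫_{-1}^1 T_n P_n = (2^{n-1}/p_n) · 2/(2n+1)` is proved; the expression is repeated here verbatim to
  keep the import closure of this file small): `wuRatio_eq_legendreLead` — the last line of CHM's proof
  of Thm 6.3, `D_{n+1}/D_n = 2^{n+1}C_n/(π(2n+1)p_n) = 2^{2n+1}/(π(2n+1)p_n²) = ρ_n`.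

So `wu_rhoCHI` is reduced to the single identity `∀ N ≥ 1, ⟨σ_{(0,0)}σ_{(N,N)}⟩⁺_{β_c(2)} = wuDiag N`
(`wu_rhoCHI_of_twoPointPlus_diag_eq`), equivalently to the CHM recurrence
(`wu_rhoCHI_of_twoPointPlus_diag_ratio`).

(History: this content first landed as `PlanarIsingOnePointProofs.lean` (p38695, 2026-08-15) and was
displaced there by a concurrent file of the same name for `chi_onePoint_rho`; it lives here since.)

## References

* T. T. Wu, Phys. Rev. 149 (1966) 380–401 (`Wu1966`).
* B. M. McCoy, T. T. Wu, *The Two-Dimensional Ising Model*, Harvard Univ. Press 1973, Chs. VIII, XI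
  (`MccoyWu1973`).
* J. H. H. Perk, H. Au-Yang, J. Stat. Phys. 135 (2009) 599–619 = arXiv:0901.1931, §2 (self-dual
  case), §4 (`PerkAuyang2009`).
* D. Chelkak, C. Hongler, K. Izyurov, Ann. of Math. 181 (2015) 1087–1138, Remark 1.2 (iii)
  (`ChelkakHonglerIzyurovAnnals2015`).
* D. Chelkak, C. Hongler, R. Mahfouf, Ann. Inst. Fourier 74 (2024) 2275–2330 = arXiv:1904.09168,
  Appendix §6, Thm. 6.3 and its proof (`ChelkakHonglerMahfouf2024`).
-/

noncomputable section

open Filter Topology Real Finset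
open scoped Nat
open Literature.Probability.LatticeModels

namespace Literature.Probability.LatticeModels

/-! ### The closed form of the critical diagonal correlation -/

/-- **McCoy–Wu's closed form of the critical diagonal two-point function** of the square-lattice
Ising model, `(2/π)^N ∏_{l=1}^{N-1} (1 - 1/(4l²))^{l-N}`, written with positive exponents as
`(2/π)^N / ∏_{l=1}^{N-1} (1 - 1/(4l²))^{N-l}` (`wuDiag 1 = 2/π`, `wuDiag 2 = 16/(3π²)`).
Perk–Au-Yang state it as the recursion `log C(n,n) = log C(n-1,n-1) + r_n`, `r_1 = log(2/π)`,
`r_{n+1} = r_n - log(1 - 1/(4n²))`, "already known to Onsager, discussed in detail by McCoy and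
Wu". [cite: PerkAuyang2009, §2 (self-dual case k = 1) and §4 (X_n(0) for J = B)] -/
def wuDiag (N : ℕ) : ℝ :=
  (2 / π) ^ N / ∏ l ∈ Finset.Ico 1 N, (1 - 1 / (4 * (l : ℝ) ^ 2)) ^ (N - l)

/-- `wuDiag 1 = 2/π`, the critical next-nearest-neighbour (diagonal) correlation.
[cite: PerkAuyang2009, §2 (r_1 = log(2/π))] -/
theorem wuDiag_one : wuDiag 1 = 2 / π := by
  simp [wuDiag]

/-- The Euler factor `b_j = 1 - 1/(4(j+1)²)` (the `l = j + 1`-st factor of Euler's product for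
`sin(πx)/(πx)` at `x = 1/2`). [folklore] -/
def wuFactor (j : ℕ) : ℝ := 1 - 1 / (4 * ((j : ℝ) + 1) ^ 2)

/-- `1/(4(j+1)²) ≤ 1/4`. [folklore] -/
theorem wuFactor_aux_le (j : ℕ) : 1 / (4 * ((j : ℝ) + 1) ^ 2) ≤ 1 / 4 := by
  apply one_div_le_one_div_of_le (by norm_num)
  have : (0 : ℝ) ≤ j := Nat.cast_nonneg j
  nlinarith

/-- `0 < 1/(4(j+1)²)`. [folklore] -/
theorem wuFactor_aux_pos (j : ℕ) : 0 < 1 / (4 * ((j : ℝ) + 1) ^ 2) := by positivity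

/-- `3/4 ≤ b_j`. [folklore] -/
theorem three_quarters_le_wuFactor (j : ℕ) : 3 / 4 ≤ wuFactor j := by
  have := wuFactor_aux_le j
  unfold wuFactor; linarith

/-- `0 < b_j`. [folklore] -/
theorem wuFactor_pos (j : ℕ) : 0 < wuFactor j :=
  lt_of_lt_of_le (by norm_num) (three_quarters_le_wuFactor j)

/-- The closed form re-indexed by `l = j + 1`:
`wuDiag (n+1) = (2/π)^{n+1} / ∏_{j<n} b_j^{n-j}`. [cite: PerkAuyang2009, §4] -/
theorem wuDiag_succ (n : ℕ) :
    wuDiag (n + 1) = (2 / π) ^ (n + 1) / ∏ j ∈ range n, wuFactor j ^ (n - j) := by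
  unfold wuDiag
  congr 1
  rw [Finset.prod_Ico_eq_prod_range]
  simp only [Nat.add_sub_cancel]
  refine Finset.prod_congr rfl fun j _ => ?_
  simp only [wuFactor, Nat.cast_add, Nat.cast_one]
  congr 1
  · ring
  · omega

/-- `wuDiag (n+1) > 0`. [folklore] -/
theorem wuDiag_succ_pos (n : ℕ) : 0 < wuDiag (n + 1) := by
  rw [wuDiag_succ]
  exact div_pos (by positivity) (Finset.prod_pos fun j _ => pow_pos (wuFactor_pos j) _)

/-! ### Euler's product at `x = 1/2` and the logarithms `u_j = -log b_j` -/

/-- **Euler–Wallis**: `∏_{j<n} (1 - 1/(4(j+1)²)) → 2/π` (`sin(π/2) = 1` in Euler's product).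
[folklore] -/
theorem tendsto_prod_wuFactor :
    Tendsto (fun n : ℕ => ∏ j ∈ range n, wuFactor j) atTop (𝓝 (2 / π)) := by
  have h := Real.tendsto_euler_sin_prod (1 / 2 : ℝ)
  have hsin : Real.sin (π * (1 / 2)) = 1 := by
    rw [show π * (1 / 2) = π / 2 by ring, Real.sin_pi_div_two]
  rw [hsin] at h
  have h2 := h.const_mul (2 / π)
  rw [mul_one] at h2
  refine h2.congr fun n => ?_
  have hπ : π ≠ 0 := Real.pi_ne_zero
  rw [← mul_assoc, ← mul_assoc, show 2 / π * π * (1 / 2) = 1 by field_simp, one_mul]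
  refine Finset.prod_congr rfl fun j _ => ?_
  unfold wuFactor
  congr 1
  rw [div_eq_div_iff (by positivity) (by positivity)]
  ring

/-- `u_j = -log b_j`, the logarithm of the Euler factor. [folklore] -/
def wuLog (j : ℕ) : ℝ := -Real.log (wuFactor j)

/-- `u_j ≥ 1/(4(j+1)²)` (from `log y ≤ y - 1`). [folklore] -/
theorem aux_le_wuLog (j : ℕ) : 1 / (4 * ((j : ℝ) + 1) ^ 2) ≤ wuLog j := by
  have h := Real.log_le_sub_one_of_pos (wuFactor_pos j)
  unfold wuLog; unfold wuFactor at h ⊢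
  linarith

/-- `u_j ≥ 0`. [folklore] -/
theorem wuLog_nonneg (j : ℕ) : 0 ≤ wuLog j :=
  (wuFactor_aux_pos j).le.trans (aux_le_wuLog j)

/-- The remainder `r_j = u_j - 1/(4(j+1)²)`. [folklore] -/
def wuRem (j : ℕ) : ℝ := wuLog j - 1 / (4 * ((j : ℝ) + 1) ^ 2)

/-- `u_j = ¼ · 1/(j+1)² + r_j`. [folklore] -/
theorem wuLog_eq (j : ℕ) : wuLog j = 1 / 4 * (1 / ((j : ℝ) + 1) ^ 2) + wuRem j := by
  have hj : (0 : ℝ) < ((j : ℝ) + 1) ^ 2 := by positivity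
  simp only [wuRem]
  field_simp
  ring

/-- `r_j ≥ 0`. [folklore] -/
theorem wuRem_nonneg (j : ℕ) : 0 ≤ wuRem j := by
  have := aux_le_wuLog j
  unfold wuRem; linarith

/-- `r_j ≤ 1/(12 (j+1)⁴)` (from `1 - 1/y ≤ log y`: `-log(1-x) ≤ x/(1-x)`, so
`r ≤ x²/(1-x) ≤ (4/3) x²` with `x = 1/(4(j+1)²) ≤ 1/4`). [folklore] -/
theorem wuRem_le (j : ℕ) : wuRem j ≤ 1 / (12 * ((j : ℝ) + 1) ^ 4) := by
  set x : ℝ := 1 / (4 * ((j : ℝ) + 1) ^ 2) with hx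
  have hx1 : x ≤ 1 / 4 := wuFactor_aux_le j
  have h1x : 0 < 1 - x := by linarith
  have hlog : 1 - (1 - x)⁻¹ ≤ Real.log (1 - x) := Real.one_sub_inv_le_log_of_pos h1x
  have hu : wuLog j ≤ x / (1 - x) := by
    have h1 : wuLog j = -Real.log (1 - x) := rfl
    have h2 : x / (1 - x) = (1 - x)⁻¹ - 1 := by field_simp; ring
    rw [h1, h2]; linarith
  have hr : wuRem j = wuLog j - x := rfl
  have hq : x / (1 - x) - x = x ^ 2 / (1 - x) := by field_simp; ring
  have h34 : 3 / 4 ≤ 1 - x := by linarith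
  calc wuRem j ≤ x / (1 - x) - x := by rw [hr]; linarith
    _ = x ^ 2 / (1 - x) := hq
    _ ≤ x ^ 2 / (3 / 4) := div_le_div_of_nonneg_left (sq_nonneg x) (by norm_num) h34
    _ = 1 / (12 * ((j : ℝ) + 1) ^ 4) := by rw [hx]; field_simp; ring

/-- **Euler's product in logarithmic form**: `∑_{j ≥ 0} u_j = log(π/2)`. [folklore] -/
theorem hasSum_wuLog : HasSum wuLog (Real.log (π / 2)) := by
  refine (hasSum_iff_tendsto_nat_of_nonneg wuLog_nonneg _).2 ?_
  have hne : (2 / π : ℝ) ≠ 0 := by positivity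
  have h := tendsto_prod_wuFactor.log hne
  have h2 : Real.log (2 / π) = -Real.log (π / 2) := by
    rw [← Real.log_inv, inv_div]
  rw [h2] at h
  have h3 := h.neg
  rw [neg_neg] at h3
  refine h3.congr fun n => ?_
  rw [Real.log_prod (fun j _ => (wuFactor_pos j).ne')]
  simp only [wuLog, Finset.sum_neg_distrib]

/-! ### Summability of the pieces -/

/-- `∑ 1/(j+1)^p` converges for `p ≥ 2`. [folklore] -/
theorem summable_one_div_succ_pow {p : ℕ} (hp : 1 < p) :
    Summable fun j : ℕ => 1 / ((j : ℝ) + 1) ^ p := by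
  have h := (summable_nat_add_iff 1).2 (Real.summable_one_div_nat_pow.2 hp)
  simpa [Nat.cast_add, Nat.cast_one] using h

/-- `r` is summable (`0 ≤ r_j ≤ 1/(12(j+1)⁴)`). [folklore] -/
theorem summable_wuRem : Summable wuRem := by
  refine Summable.of_nonneg_of_le wuRem_nonneg wuRem_le ?_
  have h := (summable_one_div_succ_pow (p := 4) (by norm_num)).mul_left (1 / 12)
  refine h.congr fun j => ?_
  rw [one_div_mul_one_div_rev, mul_comm]

/-- `(j+1) r_j` is summable (`≤ 1/(12 (j+1)³)`). [folklore] -/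
theorem summable_succ_mul_wuRem : Summable fun j : ℕ => ((j : ℝ) + 1) * wuRem j := by
  refine Summable.of_nonneg_of_le (fun j => mul_nonneg (by positivity) (wuRem_nonneg j))
    (fun j => ?_) ((summable_one_div_succ_pow (p := 3) (by norm_num)).mul_left (1 / 12))
  have hj : (0 : ℝ) < (j : ℝ) + 1 := by positivity
  calc ((j : ℝ) + 1) * wuRem j ≤ ((j : ℝ) + 1) * (1 / (12 * ((j : ℝ) + 1) ^ 4)) :=
        mul_le_mul_of_nonneg_left (wuRem_le j) hj.le
    _ = 1 / 12 * (1 / ((j : ℝ) + 1) ^ 3) := by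
        have hj' : (j : ℝ) + 1 ≠ 0 := hj.ne'
        field_simp

/-! ### Telescoping bounds for the tail `∑_{m > n} 1/m²` -/

/-- **Telescoping**: `∑_{j ≥ 0} 1/((j+m)(j+m+1)) = 1/m` for `m > 0`. [folklore] -/
theorem hasSum_telescope {m : ℝ} (hm : 0 < m) :
    HasSum (fun j : ℕ => 1 / (((j : ℝ) + m) * ((j : ℝ) + m + 1))) (1 / m) := by
  have hnn : ∀ j : ℕ, 0 ≤ 1 / (((j : ℝ) + m) * ((j : ℝ) + m + 1)) := fun j => by positivity
  refine (hasSum_iff_tendsto_nat_of_nonneg hnn _).2 ?_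
  have hpartial : ∀ n : ℕ, ∑ j ∈ range n, 1 / (((j : ℝ) + m) * ((j : ℝ) + m + 1)) =
      1 / m - 1 / ((n : ℝ) + m) := by
    intro n
    induction n with
    | zero => simp
    | succ n ih =>
      rw [Finset.sum_range_succ, ih]
      have h1 : (n : ℝ) + m ≠ 0 := by positivity
      have h2 : (n : ℝ) + m + 1 ≠ 0 := by positivity
      have h3 : (n : ℝ) + 1 + m ≠ 0 := by positivity
      have h4 : m ≠ 0 := hm.ne'
      push_cast
      field_simp
      ring
  simp_rw [hpartial]
  have h0 : Tendsto (fun n : ℕ => 1 / ((n : ℝ) + m)) atTop (𝓝 0) :=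
    tendsto_const_nhds.div_atTop (tendsto_natCast_atTop_atTop.atTop_add tendsto_const_nhds)
  have := (tendsto_const_nhds (x := 1 / m) (f := (atTop : Filter ℕ))).sub h0
  rwa [sub_zero] at this

/-- `(n+1) · (Q - ∑_{j<n} 1/(j+1)²) → 1` where `Q = ∑_{j≥0} 1/(j+1)²`: the tail of `∑ 1/m²`
beyond `n` is squeezed between `1/(n+1)` and `1/n` by telescoping. [folklore] -/
theorem tendsto_succ_mul_tail_inv_sq {Q : ℝ} (hQ : HasSum (fun j : ℕ => 1 / ((j : ℝ) + 1) ^ 2) Q) :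
    Tendsto (fun n : ℕ => ((n : ℝ) + 1) * (Q - ∑ j ∈ range n, 1 / ((j : ℝ) + 1) ^ 2))
      atTop (𝓝 1) := by
  -- the tail as a `HasSum`
  have htail : ∀ n : ℕ, HasSum (fun j : ℕ => 1 / (((j + n : ℕ) : ℝ) + 1) ^ 2)
      (Q - ∑ j ∈ range n, 1 / ((j : ℝ) + 1) ^ 2) := fun n => (hasSum_nat_add_iff' n).2 hQ
  -- lower bound: `1/(n+1) ≤ tail n`
  have hlow : ∀ n : ℕ, 1 / ((n : ℝ) + 1) ≤ Q - ∑ j ∈ range n, 1 / ((j : ℝ) + 1) ^ 2 := by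
    intro n
    have hm : (0 : ℝ) < (n : ℝ) + 1 := by positivity
    refine hasSum_le (fun j => ?_) (hasSum_telescope hm) (htail n)
    push_cast
    apply one_div_le_one_div_of_le (by positivity)
    nlinarith
  -- upper bound: `tail n ≤ 1/n` for `n ≥ 1`
  have hup : ∀ n : ℕ, 1 ≤ n → Q - ∑ j ∈ range n, 1 / ((j : ℝ) + 1) ^ 2 ≤ 1 / (n : ℝ) := by
    intro n hn
    have hm : (0 : ℝ) < (n : ℝ) := by exact_mod_cast hn
    refine hasSum_le (fun j => ?_) (htail n) (hasSum_telescope hm)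
    push_cast
    have ha : (0 : ℝ) < (j : ℝ) + (n : ℝ) := by positivity
    apply one_div_le_one_div_of_le (by positivity)
    nlinarith
  -- squeeze
  have hl : Tendsto (fun n : ℕ => ((n : ℝ) + 1) * (1 / ((n : ℝ) + 1))) atTop (𝓝 1) := by
    refine tendsto_const_nhds.congr fun n => ?_
    have : (0 : ℝ) < (n : ℝ) + 1 := by positivity
    field_simp
  have hu : Tendsto (fun n : ℕ => ((n : ℝ) + 1) * (1 / (n : ℝ))) atTop (𝓝 1) := by
    have h1 := (tendsto_one_div_atTop_nhds_zero_nat (𝕜 := ℝ)).const_add 1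
    rw [add_zero] at h1
    refine h1.congr' ?_
    filter_upwards [eventually_ge_atTop 1] with n hn
    have : (0 : ℝ) < (n : ℝ) := by exact_mod_cast hn
    field_simp
  refine tendsto_of_tendsto_of_tendsto_of_le_of_le' hl hu ?_ ?_
  · filter_upwards with n
    exact mul_le_mul_of_nonneg_left (hlow n) (by positivity)
  · filter_upwards [eventually_ge_atTop 1] with n hn
    exact mul_le_mul_of_nonneg_left (hup n hn) (by positivity)

/-- `(n+1) · (R - ∑_{j<n} r_j) → 0` where `R = ∑_{j ≥ 0} r_j`: since
`0 ≤ r_{j+n} ≤ 1/(12 (n+1)² (j+1)²)`, the tail is `O(1/(n+1)²)`. [folklore] -/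
theorem tendsto_succ_mul_tail_wuRem :
    Tendsto (fun n : ℕ => ((n : ℝ) + 1) * (∑' j : ℕ, wuRem j - ∑ j ∈ range n, wuRem j))
      atTop (𝓝 0) := by
  set R : ℝ := ∑' j : ℕ, wuRem j
  have hR : HasSum wuRem R := summable_wuRem.hasSum
  have htail : ∀ n : ℕ, HasSum (fun j : ℕ => wuRem (j + n)) (R - ∑ j ∈ range n, wuRem j) :=
    fun n => (hasSum_nat_add_iff' n).2 hR
  obtain ⟨Z, hZ⟩ := summable_one_div_succ_pow (p := 2) (by norm_num)
  -- bound on the tail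
  have hbd : ∀ n : ℕ, R - ∑ j ∈ range n, wuRem j ≤ 1 / (12 * ((n : ℝ) + 1) ^ 2) * Z := by
    intro n
    refine hasSum_le (fun j => ?_) (htail n) (hZ.mul_left _)
    refine (wuRem_le (j + n)).trans ?_
    push_cast
    have hn1 : (0 : ℝ) < (n : ℝ) + 1 := by positivity
    have hj1 : (0 : ℝ) < (j : ℝ) + 1 := by positivity
    rw [one_div_mul_one_div_rev, mul_comm (((j : ℝ) + 1) ^ 2)]
    apply one_div_le_one_div_of_le (by positivity)
    have hprod : ((n : ℝ) + 1) * ((j : ℝ) + 1) ≤ ((j : ℝ) + n + 1) ^ 2 := by nlinarith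
    have h0 : (0 : ℝ) ≤ ((n : ℝ) + 1) * ((j : ℝ) + 1) := by positivity
    calc 12 * ((n : ℝ) + 1) ^ 2 * ((j : ℝ) + 1) ^ 2
        = 12 * (((n : ℝ) + 1) * ((j : ℝ) + 1)) ^ 2 := by ring
      _ ≤ 12 * (((j : ℝ) + n + 1) ^ 2) ^ 2 := by gcongr
      _ = 12 * ((j : ℝ) + n + 1) ^ 4 := by ring
  have hnn : ∀ n : ℕ, 0 ≤ R - ∑ j ∈ range n, wuRem j := fun n =>
    (htail n).nonneg fun j => wuRem_nonneg _
  refine squeeze_zero (fun n => mul_nonneg (by positivity) (hnn n))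
    (fun n => mul_le_mul_of_nonneg_left (hbd n) (by positivity)) ?_
  have h : Tendsto (fun n : ℕ => Z / 12 * (1 / ((n : ℝ) + 1))) atTop (𝓝 0) := by
    simpa using (tendsto_one_div_add_atTop_nhds_zero_nat (𝕜 := ℝ)).const_mul (Z / 12)
  refine h.congr fun n => ?_
  have : (0 : ℝ) < (n : ℝ) + 1 := by positivity
  field_simp

/-! ### The logarithm of `wuDiag` -/

/-- `log wuDiag(n+1) = (n+1) log(2/π) + ∑_{j<n} (n-j) u_j`. [cite: PerkAuyang2009, §2] -/
theorem log_wuDiag_succ (n : ℕ) :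
    Real.log (wuDiag (n + 1)) =
      ((n : ℝ) + 1) * Real.log (2 / π) + ∑ j ∈ range n, ((n : ℝ) - j) * wuLog j := by
  rw [wuDiag_succ, Real.log_div (by positivity)
    (Finset.prod_pos fun j _ => pow_pos (wuFactor_pos j) _).ne', Real.log_pow,
    Real.log_prod (fun j _ => (pow_pos (wuFactor_pos j) _).ne')]
  push_cast
  rw [sub_eq_add_neg, ← Finset.sum_neg_distrib]
  congr 1
  refine Finset.sum_congr rfl fun j hj => ?_
  rw [Real.log_pow, Nat.cast_sub (Finset.mem_range.1 hj).le]
  simp only [wuLog]; ring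

/-- The tail form: `log wuDiag(n+1) = -(n+1) (log(π/2) - ∑_{j<n} u_j) - ∑_{j<n} (j+1) u_j`
(Euler's product absorbs the linear term). [folklore] -/
theorem log_wuDiag_succ_eq_tail (n : ℕ) :
    Real.log (wuDiag (n + 1)) =
      -(((n : ℝ) + 1) * (Real.log (π / 2) - ∑ j ∈ range n, wuLog j)) -
        ∑ j ∈ range n, ((j : ℝ) + 1) * wuLog j := by
  rw [log_wuDiag_succ]
  have h2 : Real.log (2 / π) = -Real.log (π / 2) := by
    rw [← Real.log_inv, inv_div]
  rw [h2]
  have h3 : ∑ j ∈ range n, ((n : ℝ) - j) * wuLog j =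
      ((n : ℝ) + 1) * ∑ j ∈ range n, wuLog j - ∑ j ∈ range n, ((j : ℝ) + 1) * wuLog j := by
    rw [Finset.mul_sum, ← Finset.sum_sub_distrib]
    refine Finset.sum_congr rfl fun j _ => ?_
    ring
  rw [h3]; ring

/-- `∑_{j<n} (j+1) u_j = ¼ H_n + ∑_{j<n} (j+1) r_j`. [folklore] -/
theorem sum_succ_mul_wuLog (n : ℕ) :
    ∑ j ∈ range n, ((j : ℝ) + 1) * wuLog j =
      1 / 4 * ∑ j ∈ range n, 1 / ((j : ℝ) + 1) + ∑ j ∈ range n, ((j : ℝ) + 1) * wuRem j := by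
  rw [Finset.mul_sum, ← Finset.sum_add_distrib]
  refine Finset.sum_congr rfl fun j _ => ?_
  have hj : (0 : ℝ) < (j : ℝ) + 1 := by positivity
  rw [wuLog_eq]
  field_simp

/-- `∑_{j<n} u_j = ¼ ∑_{j<n} 1/(j+1)² + ∑_{j<n} r_j`. [folklore] -/
theorem sum_wuLog (n : ℕ) :
    ∑ j ∈ range n, wuLog j =
      1 / 4 * ∑ j ∈ range n, 1 / ((j : ℝ) + 1) ^ 2 + ∑ j ∈ range n, wuRem j := by
  rw [Finset.mul_sum, ← Finset.sum_add_distrib]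
  exact Finset.sum_congr rfl fun j _ => wuLog_eq j

/-- The harmonic number as a real sum: `H_n = ∑_{j<n} 1/(j+1)`. [folklore] -/
theorem harmonic_cast_eq_sum (n : ℕ) :
    ((harmonic n : ℚ) : ℝ) = ∑ j ∈ range n, 1 / ((j : ℝ) + 1) := by
  induction n with
  | zero => simp
  | succ n ih =>
    rw [harmonic_succ, Finset.sum_range_succ, Rat.cast_add, ih]
    push_cast
    ring

/-! ### Assembly: the asymptotics of `wuDiag` -/

/-- `log wuDiag(n+1) + ¼ log(n+1)` converges (to `-¼ - ¼γ - ∑_j (j+1) r_j`).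
[cite: MccoyWu1973, Ch. XI (T = T_c asymptotics of the diagonal correlation)] -/
theorem tendsto_log_wuDiag_succ_add :
    ∃ L : ℝ, Tendsto (fun n : ℕ => Real.log (wuDiag (n + 1)) + 1 / 4 * Real.log ((n : ℝ) + 1))
      atTop (𝓝 L) := by
  -- the constants
  obtain ⟨Q, hQ⟩ := summable_one_div_succ_pow (p := 2) (by norm_num)
  set R : ℝ := ∑' j : ℕ, wuRem j
  have hR : HasSum wuRem R := summable_wuRem.hasSum
  set W : ℝ := ∑' j : ℕ, ((j : ℝ) + 1) * wuRem j
  have hW : HasSum (fun j : ℕ => ((j : ℝ) + 1) * wuRem j) W := summable_succ_mul_wuRem.hasSum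
  -- `∑ u_j = Q/4 + R`
  have hU : Real.log (π / 2) = 1 / 4 * Q + R := by
    have h1 : HasSum wuLog (1 / 4 * Q + R) := by
      have := (hQ.mul_left (1 / 4)).add hR
      exact this.congr_fun fun j => (wuLog_eq j)
    exact hasSum_wuLog.unique h1
  -- the limit
  have h1 := tendsto_succ_mul_tail_inv_sq hQ
  have h2 := tendsto_succ_mul_tail_wuRem
  have h3 := Real.tendsto_harmonic_sub_log_add_one
  have h4 := hW.tendsto_sum_nat
  have hlim := ((((h1.const_mul (1 / 4)).add h2).neg.sub (h3.const_mul (1 / 4))).sub h4)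
  refine ⟨_, hlim.congr fun n => ?_⟩
  rw [log_wuDiag_succ_eq_tail, hU, sum_wuLog, sum_succ_mul_wuLog, harmonic_cast_eq_sum]
  ring

/-- **The analytic half of Wu's theorem**: `N^{1/4} · (2/π)^N ∏_{l=1}^{N-1}(1 - 1/(4l²))^{l-N}`
converges to a positive limit as `N → ∞` (Wu 1966; McCoy–Wu 1973, Ch. XI: the limit is
`A = 2^{1/12} e^{3ζ'(-1)}`; only existence and positivity are proved here).
[cite: MccoyWu1973, Ch. XI (T = T_c asymptotics of the diagonal correlation); Wu1966] -/
theorem exists_tendsto_rpow_mul_wuDiag :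
    ∃ A : ℝ, 0 < A ∧ Tendsto (fun N : ℕ => (N : ℝ) ^ ((1 : ℝ) / 4) * wuDiag N) atTop (𝓝 A) := by
  obtain ⟨L, hL⟩ := tendsto_log_wuDiag_succ_add
  refine ⟨Real.exp L, Real.exp_pos L, ?_⟩
  rw [← tendsto_add_atTop_iff_nat 1]
  have h := (Real.continuous_exp.tendsto L).comp hL
  refine h.congr fun n => ?_
  simp only [Function.comp_apply]
  have hn : (0 : ℝ) < ((n + 1 : ℕ) : ℝ) := by positivity
  rw [Real.rpow_def_of_pos hn, Real.exp_add, Real.exp_log (wuDiag_succ_pos n)]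
  push_cast
  rw [mul_comm (Real.log ((n : ℝ) + 1)) (1 / 4)]
  ring

/-- **`wu_rhoCHI` from the exact solution.** If the critical plus-state diagonal correlation of
`ℤ²` is given by McCoy–Wu's closed form, `⟨σ_{(0,0)}σ_{(N,N)}⟩⁺_{β_c(2)} = wuDiag N` for `N ≥ 1`
(Wu 1966; McCoy–Wu 1973, Chs. VIII, XI; Perk–Au-Yang 2009, §§2, 4 — the exact-solution input,
taken here as an explicit hypothesis and not vendored as a named fact), then CHI's Remark 1.2
(iii) holds: `δ^{-1/4} ϱ(δ) → C₂ > 0` (through `wu_rhoCHI_of_tendsto_diag`).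
[cite: ChelkakHonglerIzyurovAnnals2015, Remark 1.2 (iii); Wu1966] -/
theorem wu_rhoCHI_of_twoPointPlus_diag_eq
    (h : ∀ N : ℕ, 1 ≤ N → twoPointPlus 2 criticalBetaTwo ![(N : ℤ), (N : ℤ)] = wuDiag N) :
    wu_rhoCHI := by
  obtain ⟨A, hA, hT⟩ := exists_tendsto_rpow_mul_wuDiag
  refine wu_rhoCHI_of_tendsto_diag ⟨A, hA, hT.congr' ?_⟩
  filter_upwards [eventually_ge_atTop 1] with N hN
  rw [h N hN]


/-! ### The recurrence form (Chelkak–Hongler–Mahfouf) -/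

/-- `wuDiag 0 = 1` (`⟨σ_0 σ_0⟩ = 1`). [folklore] -/
theorem wuDiag_zero : wuDiag 0 = 1 := by
  simp [wuDiag]

/-- `∏_{j<n+1} b_j^{(n+1)-j} = (∏_{j<n} b_j^{n-j}) · ∏_{j<n+1} b_j`. [folklore] -/
theorem prod_wuFactor_pow_succ (n : ℕ) :
    ∏ j ∈ range (n + 1), wuFactor j ^ (n + 1 - j) =
      (∏ j ∈ range n, wuFactor j ^ (n - j)) * ∏ j ∈ range (n + 1), wuFactor j := by
  rw [Finset.prod_range_succ, Finset.prod_range_succ (fun j => wuFactor j), Nat.add_sub_cancel_left,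
    pow_one, ← mul_assoc, ← Finset.prod_mul_distrib]
  congr 1
  refine Finset.prod_congr rfl fun j hj => ?_
  rw [← pow_succ, Nat.sub_add_comm (Finset.mem_range.1 hj).le]

/-- **The closed form as a recurrence**: `wuDiag (n+1) = wuDiag n · (2/π) / ∏_{j<n} (1 - 1/(4(j+1)²))`
(Perk–Au-Yang: `r_{n+1} = r_n - log(1 - 1/(4n²))`, `r_1 = log(2/π)`).
[cite: PerkAuyang2009, §2 (self-dual case k = 1)] -/
theorem wuDiag_succ_eq_mul (n : ℕ) :
    wuDiag (n + 1) = wuDiag n * (2 / π / ∏ j ∈ range n, wuFactor j) := by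
  cases n with
  | zero => simp [wuDiag]
  | succ m =>
    rw [wuDiag_succ, wuDiag_succ, prod_wuFactor_pow_succ, div_mul_div_comm, ← pow_succ]

/-- `(2n+1)‼ = (2n+1) · (2n-1)‼` (also for `n = 0`, where `(0-1)‼ = 0‼ = 1`). [folklore] -/
theorem doubleFactorial_two_mul_add_one (n : ℕ) : (2 * n + 1)‼ = (2 * n + 1) * (2 * n - 1)‼ :=
  Nat.doubleFactorial_add_one (2 * n)

/-- **Wallis' partial products in double factorials**:
`∏_{j<n} (1 - 1/(4(j+1)²)) = (2n-1)‼ (2n+1)‼ / ((2n)‼)²` (`1 - 1/(4l²) = (2l-1)(2l+1)/(2l)²`).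
[folklore] -/
theorem prod_wuFactor_eq_doubleFactorial (n : ℕ) :
    ∏ j ∈ range n, wuFactor j = ((2 * n - 1)‼ * (2 * n + 1)‼ : ℝ) / ((2 * n)‼ : ℝ) ^ 2 := by
  induction n with
  | zero => simp
  | succ n ih =>
    rw [Finset.prod_range_succ, ih]
    have e1 : (2 * (n + 1) - 1)‼ = (2 * n + 1) * (2 * n - 1)‼ := by
      rw [show 2 * (n + 1) - 1 = 2 * n + 1 by omega]; exact doubleFactorial_two_mul_add_one n
    have e2 : (2 * (n + 1) + 1)‼ = (2 * n + 3) * (2 * n + 1)‼ := by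
      rw [show 2 * (n + 1) + 1 = 2 * n + 1 + 2 by ring]; exact Nat.doubleFactorial_add_two _
    have e3 : (2 * (n + 1))‼ = (2 * n + 2) * (2 * n)‼ := by
      rw [show 2 * (n + 1) = 2 * n + 2 by ring]; exact Nat.doubleFactorial_add_two _
    rw [e1, e2, e3]
    have h0 : ((2 * n)‼ : ℝ) ≠ 0 := by exact_mod_cast (Nat.doubleFactorial_pos _).ne'
    have h1 : ((2 * n - 1)‼ : ℝ) ≠ 0 := by exact_mod_cast (Nat.doubleFactorial_pos _).ne'
    have h2 : ((2 * n + 1)‼ : ℝ) ≠ 0 := by exact_mod_cast (Nat.doubleFactorial_pos _).ne'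
    have hj : (n : ℝ) + 1 ≠ 0 := by positivity
    unfold wuFactor
    push_cast
    field_simp
    ring

/-- **Chelkak–Hongler–Mahfouf's ratio** `ρ_n = (2/π) · ((2n)‼)² / ((2n-1)‼ (2n+1)‼)`, the right-hand
side of their recurrence `D_{n+1}/D_n = ρ_n` for the critical diagonal correlations
(Ann. Inst. Fourier (2024) = arXiv:1904.09168, Appendix, proof of Thm 6.3 "(Wu)": from the norms
`‖P_n‖² = 2/(2n+1)` of the Legendre polynomials).
[cite: ChelkakHonglerMahfouf2024, Appendix §6, proof of Thm. 6.3 (Wu)] -/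
def wuRatio (n : ℕ) : ℝ :=
  2 / π * ((2 * n)‼ : ℝ) ^ 2 / ((2 * n - 1)‼ * (2 * n + 1)‼ : ℝ)

/-- `ρ_0 = 2/π`. [folklore] -/
theorem wuRatio_zero : wuRatio 0 = 2 / π := by
  simp [wuRatio]

/-- `ρ_n > 0`. [folklore] -/
theorem wuRatio_pos (n : ℕ) : 0 < wuRatio n := by
  unfold wuRatio
  have h0 : (0 : ℝ) < (2 * n)‼ := by exact_mod_cast Nat.doubleFactorial_pos _
  have h1 : (0 : ℝ) < (2 * n - 1)‼ := by exact_mod_cast Nat.doubleFactorial_pos _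
  have h2 : (0 : ℝ) < (2 * n + 1)‼ := by exact_mod_cast Nat.doubleFactorial_pos _
  positivity

/-- `ρ_n = (2/π) / ∏_{j<n} (1 - 1/(4(j+1)²))`. [folklore] -/
theorem wuRatio_eq_div_prod (n : ℕ) : wuRatio n = 2 / π / ∏ j ∈ range n, wuFactor j := by
  rw [prod_wuFactor_eq_doubleFactorial, wuRatio]
  have h0 : ((2 * n)‼ : ℝ) ≠ 0 := by exact_mod_cast (Nat.doubleFactorial_pos _).ne'
  have h1 : ((2 * n - 1)‼ : ℝ) ≠ 0 := by exact_mod_cast (Nat.doubleFactorial_pos _).ne'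
  have h2 : ((2 * n + 1)‼ : ℝ) ≠ 0 := by exact_mod_cast (Nat.doubleFactorial_pos _).ne'
  field_simp

/-- **McCoy–Wu's closed form satisfies the CHM recurrence**: `wuDiag (n+1) = wuDiag n · ρ_n`,
`wuDiag 0 = 1`. [cite: PerkAuyang2009, §2 (self-dual case k = 1)] -/
theorem wuDiag_succ_eq_mul_wuRatio (n : ℕ) : wuDiag (n + 1) = wuDiag n * wuRatio n := by
  rw [wuRatio_eq_div_prod, wuDiag_succ_eq_mul]

/-- `wuDiag n > 0` for every `n`. [folklore] -/
theorem wuDiag_pos (n : ℕ) : 0 < wuDiag n := by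
  cases n with
  | zero => rw [wuDiag_zero]; exact one_pos
  | succ m => exact wuDiag_succ_pos m

/-- **Uniqueness for the recurrence**: a sequence with `D_0 = 1` and `D_{n+1} = D_n · ρ_n` is
`wuDiag` (this is how Chelkak–Hongler–Mahfouf conclude Wu's formula "by induction").
[cite: ChelkakHonglerMahfouf2024, Appendix §6, proof of Thm. 6.3 (Wu)] -/
theorem eq_wuDiag_of_wuRatio {D : ℕ → ℝ} (h0 : D 0 = 1) (h : ∀ n, D (n + 1) = D n * wuRatio n)
    (n : ℕ) : D n = wuDiag n := by
  induction n with
  | zero => rw [h0, wuDiag_zero]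
  | succ n ih => rw [h n, ih, wuDiag_succ_eq_mul_wuRatio]

/-- **`wu_rhoCHI` from the CHM recurrence.** If the critical plus-state diagonal correlations of
`ℤ²` satisfy Chelkak–Hongler–Mahfouf's recurrence
`⟨σ_{(0,0)}σ_{(n+1,n+1)}⟩⁺_{β_c(2)} = ρ_n · ⟨σ_{(0,0)}σ_{(n,n)}⟩⁺_{β_c(2)}` (arXiv:1904.09168, proof of
Thm 6.3 — the exact-solution input in its Kadanoff–Ceva/Legendre form, an explicit hypothesis here),
then `wu_rhoCHI` holds (`⟨σ_0σ_0⟩ = 1` closes the induction).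
[cite: ChelkakHonglerIzyurovAnnals2015, Remark 1.2 (iii); ChelkakHonglerMahfouf2024, Thm. 6.3] -/
theorem wu_rhoCHI_of_twoPointPlus_diag_ratio
    (h : ∀ n : ℕ, twoPointPlus 2 criticalBetaTwo ![((n + 1 : ℕ) : ℤ), ((n + 1 : ℕ) : ℤ)] =
      twoPointPlus 2 criticalBetaTwo ![(n : ℤ), (n : ℤ)] * wuRatio n) :
    wu_rhoCHI := by
  have h0 : twoPointPlus 2 criticalBetaTwo ![((0 : ℕ) : ℤ), ((0 : ℕ) : ℤ)] = 1 := by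
    have hz : (![((0 : ℕ) : ℤ), ((0 : ℕ) : ℤ)] : Site 2) = 0 := by
      ext i; fin_cases i <;> rfl
    rw [hz]
    change limUnder atTop (fun L : ℕ => isingTwoPoint (zdGraph 2) (box 2 L) criticalBetaTwo 0 .plus 0 0) = 1
    simp only [isingTwoPoint_self]
    exact tendsto_const_nhds.limUnder_eq
  have key := eq_wuDiag_of_wuRatio (D := fun n : ℕ => twoPointPlus 2 criticalBetaTwo ![(n : ℤ), (n : ℤ)])
    h0 h
  exact wu_rhoCHI_of_twoPointPlus_diag_eq fun N _ => key N


/-! ### CHM's form of the ratio through the Legendre leading coefficient -/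

/-- `(2n)! = 2ⁿ n! (2n-1)‼`. [folklore] -/
theorem factorial_two_mul_eq (n : ℕ) : (2 * n)! = 2 ^ n * n ! * (2 * n - 1)‼ := by
  cases n with
  | zero => simp
  | succ m =>
    have h1 : (2 * (m + 1))! = (2 * (m + 1))‼ * (2 * m + 1)‼ := by
      rw [show 2 * (m + 1) = 2 * m + 1 + 1 by ring]; exact Nat.factorial_eq_mul_doubleFactorial _
    rw [h1, Nat.doubleFactorial_two_mul, show 2 * (m + 1) - 1 = 2 * m + 1 by omega]

/-- The Legendre leading coefficient `p_n = (2n)!/(2ⁿ (n!)²)` in double factorials: `p_n = (2n-1)‼ / n!`.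
[folklore] -/
theorem legendreLead_eq_doubleFactorial (n : ℕ) :
    ((2 * n)! : ℝ) / (2 ^ n * (n ! : ℝ) ^ 2) = ((2 * n - 1)‼ : ℝ) / (n ! : ℝ) := by
  rw [factorial_two_mul_eq]
  have hn : (n ! : ℝ) ≠ 0 := by positivity
  push_cast
  field_simp

/-- **Chelkak–Hongler–Mahfouf's form of Wu's ratio**: `ρ_n = 2^{2n+1} / (π (2n+1) p_n²)` with
`p_n = (2n)!/(2ⁿ (n!)²)` the leading coefficient of the Legendre polynomial `P_n`
(`Literature.Analysis.SpecialFunctions.legendreLead n`, written out) — the identity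
`2^{2n+1}/(π(2n+1)p_n²) = (2/π)·((2n)‼)²/((2n-1)‼(2n+1)‼)` that closes the proof of CHM Thm 6.3.
[cite: ChelkakHonglerMahfouf2024, Appendix §6, proof of Thm. 6.3 (Wu)] -/
theorem wuRatio_eq_legendreLead (n : ℕ) :
    wuRatio n = 2 ^ (2 * n + 1) / (π * (2 * n + 1) * (((2 * n)! : ℝ) / (2 ^ n * (n ! : ℝ) ^ 2)) ^ 2) := by
  rw [legendreLead_eq_doubleFactorial, wuRatio, doubleFactorial_two_mul_add_one,
    Nat.doubleFactorial_two_mul]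
  have hn : (n ! : ℝ) ≠ 0 := by positivity
  have h1 : ((2 * n - 1)‼ : ℝ) ≠ 0 := by exact_mod_cast (Nat.doubleFactorial_pos _).ne'
  have h3 : (2 * (n : ℝ) + 1) ≠ 0 := by positivity
  have hπ : π ≠ 0 := Real.pi_ne_zero
  push_cast
  field_simp
  ring

end Literature.Probability.LatticeModels
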